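import Mathlib
import HarnessLib
import HarnessLib.Audit
import Summits.Langlands.Langlands.Theorems.NearlyOrdinaryDistinguishedSplit

/-!
# MordellWeilFifteenSplitPrelude — lens-5 g35 node `MordellWeilFifteenSplit`, part 1 (§1–§5, §7–§8)

The Mordell–Weil GROWTH dial of `X₀(15) ≅ E₁` (15A1) and `X(s3,b5) ≅ E₂` (15A3) over the witness field (`FifteenStable`, `Growth`,
`NoQuadraticSubfield`), the ONE new print junction `FifteenModuliDoor` (moduli interpretation, [Thorne2019, Lemma 3, Prop. 4];
[Yoshikawa2022, Lemma 3.1, proof of Cor. 3.6]), the pieces `StableSector34` / `Residual35` of RES34 =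
`NearlyOrdinaryDistinguishedSplit.Residual34` and `StableFifteenCell` / `GrowthRestE` of REST_E = `DepthIsolationSplit.UnanchoredHighDegreeModularE`,
the kernel (`stableSector34_closed : BOX13 → FMD → StableSector34`, THE SPLIT `residual34_of_pieces`, exactness, `stableCell_closed : BOX13 → FMD →
DBC → StableFifteenCell`, `restE_iff_cells`), and the GENUINE lemmas: the explicit Vélu `2`-isogeny `E₂ → E₁` (`isogeny_equation`) and the
DESCENT OF STABILITY `pointsRational_E₂_of_E₁` (no quadratic subfield; [Yoshikawa2022, Lemma 3.2 / Cor. 3.3] generalised).  Part 2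
(`MordellWeilFifteenSplit.lean`) carries the full node docstring, the compositions BY NAME up to REST = stmt-Langlands-26998 and the absolute
criterion (§9).  See the node card `MordellWeilFifteenSplit.md` (HOME/decomp-langlands-lens-5/g35/node/).
-/


set_option linter.dupNamespace false
set_option linter.unusedVariables false

open scoped NumberField IntermediateField MatrixGroups Polynomial
open NumberField IsDedekindDomain Field Literature.NumberTheory.Automorphic
open Literature.NumberTheory.GaloisRepresentations
open Summit.Langlands.Langlands.Theorems.DepthIsolationSplit (UnanchoredBox UnanchoredHighDegreeModularE
  IntegralModelTransferPointwise SatakeAvatarTwo satakeAvatarTwo_of_host modularE_iff_box)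
open Summit.Langlands.Langlands.Theorems.JDegreeFilterSplit (jInv jDeg InResidualRange LargeJResidual
  RatBaseChangeModularity SmallFieldBaseChange isModularEllipticCurve_of_jInv_eq_ratCast)
open Summit.Langlands.Langlands.Theorems.DyadicDoorSplit (AllenLocus AllenDyadicCorollary DyadicDegenerateResidual)
open Summit.Langlands.Langlands.Theorems.OddPrimeDoorSplit (OffDoors SkinnerWilesDihedralDoor
  PanZhangSupersingularDoor CoreResidual core_of_restE)
open Summit.Langlands.Langlands.Theorems.RealCyclotomicDoorSplit (BorelAt BorelOrSplitCartanThree BoxShape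
  boxShape_of_box13 not_isSquare_five_of_not_two_dvd)
open Summit.Langlands.Langlands.Theorems.ReductionSignatureSplit (OffSignatureDoors NearlyOrdinaryDihedralDoorThree
  SplitOrdinaryDihedralDoor MixedSignatureDoor SignatureResidual signatureResidual_of_core)
open Summit.Langlands.Langlands.Theorems.NearlyOrdinaryDistinguishedSplit (OnNODDoor NearlyOrdinaryDistinguishedDoor
  NODSector Residual34 nodSector_closed signatureResidual_of_pieces signatureResidual_of_door residual34_of_core
  residual34_of_signatureResidual)

namespace Summit.Langlands.Langlands.Theorems.MordellWeilFifteenSplit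


/-! ## §1 The dial: Mordell–Weil stability of `X₀(15) ≅ E₁` and `X(s3,b5) ≅ E₂` over the witness field -/

/-- NO GROWTH: `E₁(K₀) = E₁(ℚ)` and `E₂(K₀) = E₂(ℚ)` (tree predicate `Thorne2019.PointsRational`). -/
def FifteenStable (K₀ : Type) [Field K₀] [NumberField K₀] : Prop :=
  Thorne2019.PointsRational Thorne2019.E₁ K₀ ∧ Thorne2019.PointsRational Thorne2019.E₂ K₀

/-- GROWTH (the asymptotic regime of the dial): `√5 ∈ K₀`, or one of `E₁`, `E₂` acquires a new `K₀`-point. -/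
def Growth (K₀ : Type) [Field K₀] [NumberField K₀] : Prop :=
  IsSquare (5 : K₀) ∨ ¬ FifteenStable K₀

/-- `K₀` has no quadratic subfield (e.g. `[K₀:ℚ]` odd, or `K₀` primitive of degree `≠ 2`). -/
def NoQuadraticSubfield (K₀ : Type) [Field K₀] [NumberField K₀] : Prop :=
  ∀ F : IntermediateField ℚ K₀, Module.finrank ℚ F ≠ 2

/-! ## §2 The ONE new print junction: the moduli interpretation of `X₀(15)` and `X(s3,b5)` -/

/-- FMD — FIFTEEN MODULI DOOR (PRINT junction; binder, credits nothing).  An integral `E / K₀` with a Borel-or-`C_s⁺(3)`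
framing of `E[3]` and a Borel framing of `E[5]` (a `K₀`-rational `5`-isogeny) defines a NON-CUSPIDAL `K₀`-point `P` of
`X(b3,b5) = X₀(15)` or of `X(s3,b5)` with `j(P) = j(E)` [Thorne2019, the paragraph before Lemma 3, after FLS2015 §5];
these curves are `ℚ`-isomorphic to `E₁`, `E₂` [Thorne2019, Prop. 4; FLS2015, Lemmas 5.6, 5.7]; if every `K₀`-point of
`E₁` and of `E₂` is `ℚ`-rational then `P` is, and `j(E) = j(P) ∈ ℚ` because the `j`-map `X → X(1)` is defined over `ℚ`.
This is exactly the step «`E` determines an `F`-rational point … hence `j ∈ ℚ`» of the proof of [Thorne2019, Lemma 3 (2)]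
(there for `F ⊂ ℚ_∞`).  NOT in the tree (no moduli interpretation of `X₀(15)` is vendored).
[ref: Thorne2019, Lemma 3 and Prop. 4] [ref: FLS2015, §5.2] [ref: Yoshikawa2022, Cor. 3.6 (the same step over `ℚ(ζ₁₆)⁺`)] -/
def FifteenModuliDoor : Prop :=
  ∀ (K₀ : Type) [Field K₀] [NumberField K₀] (E : WeierstrassCurve (𝓞 K₀)), E.Δ ≠ 0 →
    BorelOrSplitCartanThree K₀ E → BorelAt K₀ E 5 → FifteenStable K₀ → ∃ q : ℚ, (q : K₀) = jInv K₀ E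

/-! ## §3 The pieces -/

/-- STABLE SECTOR of RES34 (CLOSED from BOX13 ∧ FMD, `stableSector34_closed`): RES34 on the no-growth fields. -/
def StableSector34 : Prop :=
  ∀ (K₀ : Type) [Field K₀] [NumberField K₀], UnanchoredBox K₀ → ¬ IsSquare (5 : K₀) → FifteenStable K₀ →
    ∀ E : WeierstrassCurve (𝓞 K₀), E.Δ ≠ 0 → InResidualRange K₀ E → ¬ AllenLocus K₀ E → OffDoors K₀ E →
      OffSignatureDoors K₀ E → ¬ OnNODDoor K₀ E → IsModularEllipticCurve K₀ E

/-- Residual35 — THE DECLARED RESIDUAL (IDEA-NEEDED; INSTRUMENTABLE per field): RES34 on the GROWTH fields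
(`√5 ∈ K₀`, or `E₁(K₀) ≠ E₁(ℚ)`, or `E₂(K₀) ≠ E₂(ℚ)`). -/
def Residual35 : Prop :=
  ∀ (K₀ : Type) [Field K₀] [NumberField K₀], UnanchoredBox K₀ → Growth K₀ →
    ∀ E : WeierstrassCurve (𝓞 K₀), E.Δ ≠ 0 → InResidualRange K₀ E → ¬ AllenLocus K₀ E → OffDoors K₀ E →
      OffSignatureDoors K₀ E → ¬ OnNODDoor K₀ E → IsModularEllipticCurve K₀ E

/-- THE STABLE CELL of REST_E (CLOSED from BOX13 ∧ FMD ∧ DBC, `stableCell_closed`): every integral `E` over every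
unanchored totally real `K₀` of degree `≥ 6` with `√5 ∉ K₀`, `E₁(K₀) = E₁(ℚ)`, `E₂(K₀) = E₂(ℚ)` is modular. -/
def StableFifteenCell : Prop :=
  ∀ (K₀ : Type) [Field K₀] [NumberField K₀], UnanchoredBox K₀ → ¬ IsSquare (5 : K₀) → FifteenStable K₀ →
    ∀ E : WeierstrassCurve (𝓞 K₀), E.Δ ≠ 0 → IsModularEllipticCurve K₀ E

/-- GrowthRestE — REST_E on the growth fields (declared residual one storey up; IDEA-NEEDED). -/
def GrowthRestE : Prop :=
  ∀ (K₀ : Type) [Field K₀] [NumberField K₀], UnanchoredBox K₀ → Growth K₀ →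
    ∀ E : WeierstrassCurve (𝓞 K₀), E.Δ ≠ 0 → IsModularEllipticCurve K₀ E

/-! ## §4 Kernel: a rational `j` is never in the residual range; the stable sector is empty of candidates -/

/-- `j(E) ∈ ℚ ⇒ [ℚ(j):ℚ] ≤ 1`. -/
theorem jDeg_le_one_of_ratCast {K₀ : Type} [Field K₀] [NumberField K₀] (E : WeierstrassCurve (𝓞 K₀)) {q : ℚ}
    (hq : (q : K₀) = jInv K₀ E) : jDeg K₀ E ≤ 1 := by
  have hmem : jInv K₀ E ∈ (⊥ : IntermediateField ℚ K₀) := by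
    rw [IntermediateField.mem_bot]
    exact ⟨q, by rw [← hq]; exact eq_ratCast (algebraMap ℚ K₀) q⟩
  have hbot : ℚ⟮jInv K₀ E⟯ = ⊥ := IntermediateField.adjoin_simple_eq_bot_iff.mpr hmem
  show Module.finrank ℚ ℚ⟮jInv K₀ E⟯ ≤ 1
  rw [hbot, IntermediateField.finrank_bot]

/-- A rational `j` is NOT in the residual range (`[ℚ(j):ℚ] ≥ 4` there). -/
theorem not_inResidualRange_of_ratCast {K₀ : Type} [Field K₀] [NumberField K₀] (E : WeierstrassCurve (𝓞 K₀))
    {q : ℚ} (hq : (q : K₀) = jInv K₀ E) : ¬ InResidualRange K₀ E := by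
  have h1 := jDeg_le_one_of_ratCast E hq
  rintro (h5 | ⟨h4, -⟩)
  · exact absurd (le_trans h5 h1) (by norm_num)
  · rw [h4] at h1; exact absurd h1 (by norm_num)

/-- THE DOOR MECHANISM (pointwise): over a totally real no-growth field with `√5 ∉ K₀`, a curve that is NOT automorphic
of weight zero has RATIONAL `j` — BOX13 gives the Box shape, FMD the rational point. -/
theorem ratCast_of_not_automorphic (hB : Box2022_theorem1_3) (hF : FifteenModuliDoor) (K₀ : Type) [Field K₀]
    [NumberField K₀] [IsTotallyReal K₀] (h5 : ¬ IsSquare (5 : K₀)) (hst : FifteenStable K₀)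
    (E : WeierstrassCurve (𝓞 K₀)) (hΔ : E.Δ ≠ 0) (hne : ¬ IsAutomorphicOfWeightZero E) :
    ∃ q : ℚ, (q : K₀) = jInv K₀ E := by
  have hshape : BoxShape K₀ E := boxShape_of_box13 hB K₀ E hΔ hne
  exact hF K₀ E hΔ hshape.1 (hshape.2.1 h5) hst

/-- On a no-growth field, a curve in the residual range IS automorphic of weight zero (else its `j` would be rational). -/
theorem automorphic_of_stable (hB : Box2022_theorem1_3) (hF : FifteenModuliDoor) (K₀ : Type) [Field K₀]
    [NumberField K₀] [IsTotallyReal K₀] (h5 : ¬ IsSquare (5 : K₀)) (hst : FifteenStable K₀)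
    (E : WeierstrassCurve (𝓞 K₀)) (hΔ : E.Δ ≠ 0) (hr : InResidualRange K₀ E) : IsAutomorphicOfWeightZero E := by
  by_contra hne
  obtain ⟨q, hq⟩ := ratCast_of_not_automorphic hB hF K₀ h5 hst E hΔ hne
  exact not_inResidualRange_of_ratCast E hq hr

/-- THE STABLE SECTOR OF RES34 IS CLOSED from BOX13 ∧ FMD (no DBC needed: the sector has no candidates). -/
theorem stableSector34_closed (hB : Box2022_theorem1_3) (hF : FifteenModuliDoor) : StableSector34 := by
  intro K₀ _ _ hb h5 hst E hΔ hr _ _ _ _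
  haveI : IsTotallyReal K₀ := hb.1
  exact (IsHilbertModular.of_isAutomorphicOfWeightZero hΔ (automorphic_of_stable hB hF K₀ h5 hst E hΔ hr))
    |>.isModularEllipticCurve

/-- THE SPLIT: RES34 ⟸ BOX13 ∧ FMD ∧ Residual35 (excluded middle on growth). -/
theorem residual34_of_pieces (hB : Box2022_theorem1_3) (hF : FifteenModuliDoor) (hR : Residual35) : Residual34 := by
  intro K₀ _ _ hb E hΔ hr hA hoff h33 hn
  by_cases hg : Growth K₀
  · exact hR K₀ hb hg E hΔ hr hA hoff h33 hn
  · have h5 : ¬ IsSquare (5 : K₀) := fun h => hg (Or.inl h)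
    have hst : FifteenStable K₀ := by by_contra h; exact hg (Or.inr h)
    exact stableSector34_closed hB hF K₀ hb h5 hst E hΔ hr hA hoff h33 hn

/-- RES34 ⟸ StableSector34 ∧ Residual35 (junction-free form of the split). -/
theorem residual34_of_sectors (hS : StableSector34) (hR : Residual35) : Residual34 := by
  intro K₀ _ _ hb E hΔ hr hA hoff h33 hn
  by_cases hg : Growth K₀
  · exact hR K₀ hb hg E hΔ hr hA hoff h33 hn
  · have h5 : ¬ IsSquare (5 : K₀) := fun h => hg (Or.inl h)
    have hst : FifteenStable K₀ := by by_contra h; exact hg (Or.inr h)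
    exact hS K₀ hb h5 hst E hΔ hr hA hoff h33 hn

/-- NECESSITY: RES34 ⟹ Residual35 (a sub-family of fields). -/
theorem residual35_of_residual34 (h : Residual34) : Residual35 :=
  fun K₀ _ _ hb _ E hΔ hr hA hoff h33 hn => h K₀ hb E hΔ hr hA hoff h33 hn

/-- NECESSITY: RES34 ⟹ StableSector34. -/
theorem stableSector34_of_residual34 (h : Residual34) : StableSector34 :=
  fun K₀ _ _ hb _ _ E hΔ hr hA hoff h33 hn => h K₀ hb E hΔ hr hA hoff h33 hn

/-- EXACTNESS (no junction): RES34 ⟺ StableSector34 ∧ Residual35. -/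
theorem residual34_iff_sectors : Residual34 ↔ StableSector34 ∧ Residual35 :=
  ⟨fun h => ⟨stableSector34_of_residual34 h, residual35_of_residual34 h⟩, fun h => residual34_of_sectors h.1 h.2⟩

/-- EXACTNESS modulo the junctions: BOX13 → FMD → (RES34 ⟺ Residual35). -/
theorem residual34_iff_residual35 (hB : Box2022_theorem1_3) (hF : FifteenModuliDoor) : Residual34 ↔ Residual35 :=
  ⟨residual35_of_residual34, residual34_of_pieces hB hF⟩

/-! ## §5 One storey up: the STABLE CELL of REST_E is closed (BOX13 ∧ FMD ∧ DBC) -/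

/-- THE STABLE CELL IS CLOSED: an automorphic curve is modular; a non-automorphic one has rational `j` (BOX13 ∧ FMD) and
is then modular by g27's rational-`j` door (a quadratic twist of a base change from `ℚ`; DBC). -/
theorem stableCell_closed (hB : Box2022_theorem1_3) (hF : FifteenModuliDoor) (hDBC : RatBaseChangeModularity) :
    StableFifteenCell := by
  intro K₀ _ _ hb h5 hst E hΔ
  haveI : IsTotallyReal K₀ := hb.1
  by_cases hmod : IsAutomorphicOfWeightZero E
  · exact (IsHilbertModular.of_isAutomorphicOfWeightZero hΔ hmod).isModularEllipticCurve
  · obtain ⟨q, hq⟩ := ratCast_of_not_automorphic hB hF K₀ h5 hst E hΔ hmod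
    exact isModularEllipticCurve_of_jInv_eq_ratCast hDBC K₀ E hΔ q hq.symm

/-- THE SPLIT one storey up: REST_E ⟸ StableFifteenCell ∧ GrowthRestE. -/
theorem restE_of_cells (hS : StableFifteenCell) (hG : GrowthRestE) : UnanchoredHighDegreeModularE := by
  rw [modularE_iff_box]
  intro K₀ _ _ hb E hΔ
  by_cases hg : Growth K₀
  · exact hG K₀ hb hg E hΔ
  · have h5 : ¬ IsSquare (5 : K₀) := fun h => hg (Or.inl h)
    have hst : FifteenStable K₀ := by by_contra h; exact hg (Or.inr h)
    exact hS K₀ hb h5 hst E hΔ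

/-- REST_E ⟸ BOX13 ∧ FMD ∧ DBC ∧ GrowthRestE. -/
theorem restE_of_growth (hB : Box2022_theorem1_3) (hF : FifteenModuliDoor) (hDBC : RatBaseChangeModularity)
    (hG : GrowthRestE) : UnanchoredHighDegreeModularE :=
  restE_of_cells (stableCell_closed hB hF hDBC) hG

/-- NECESSITY: REST_E ⟹ GrowthRestE. -/
theorem growthRestE_of_restE (h : UnanchoredHighDegreeModularE) : GrowthRestE :=
  fun K₀ _ _ hb _ E hΔ => (modularE_iff_box.mp h) K₀ hb E hΔ

/-- NECESSITY: REST_E ⟹ StableFifteenCell. -/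
theorem stableCell_of_restE (h : UnanchoredHighDegreeModularE) : StableFifteenCell :=
  fun K₀ _ _ hb _ _ E hΔ => (modularE_iff_box.mp h) K₀ hb E hΔ

/-- EXACTNESS (no junction): REST_E ⟺ StableFifteenCell ∧ GrowthRestE. -/
theorem restE_iff_cells : UnanchoredHighDegreeModularE ↔ StableFifteenCell ∧ GrowthRestE :=
  ⟨fun h => ⟨stableCell_of_restE h, growthRestE_of_restE h⟩, fun h => restE_of_cells h.1 h.2⟩

/-- EXACTNESS modulo the junctions: BOX13 → FMD → DBC → (REST_E ⟺ GrowthRestE). -/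
theorem restE_iff_growthRestE (hB : Box2022_theorem1_3) (hF : FifteenModuliDoor) (hDBC : RatBaseChangeModularity) :
    UnanchoredHighDegreeModularE ↔ GrowthRestE :=
  ⟨growthRestE_of_restE, restE_of_growth hB hF hDBC⟩

/-- The two storeys agree: GrowthRestE ⟹ Residual35 (the lineage's curve-local hypotheses are simply dropped). -/
theorem residual35_of_growthRestE (h : GrowthRestE) : Residual35 :=
  fun K₀ _ _ hb hg E hΔ _ _ _ _ _ => h K₀ hb hg E hΔ

/-! ## §7 GENUINE LEMMAS: the explicit `2`-isogeny `E₂ → E₁` and the descent of stability -/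

/-- The Weierstrass equation of `E₁ = [1,1,1,−10,−10]` over any `ℚ`-algebra. -/
theorem E₁_equation_iff {K : Type} [Field K] [Algebra ℚ K] (x y : K) :
    (Thorne2019.E₁.baseChange K).toAffine.Equation x y ↔ y ^ 2 + x * y + y = x ^ 3 + x ^ 2 - 10 * x - 10 := by
  rw [WeierstrassCurve.Affine.equation_iff]
  simp only [WeierstrassCurve.baseChange, WeierstrassCurve.map_a₁, WeierstrassCurve.map_a₂,
    WeierstrassCurve.map_a₃, WeierstrassCurve.map_a₄, WeierstrassCurve.map_a₆, Thorne2019.E₁, map_one, map_neg,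
    map_ofNat, one_mul]
  constructor <;> intro h <;> linear_combination h

/-- The Weierstrass equation of `E₂ = [1,1,1,−5,2]` over any `ℚ`-algebra. -/
theorem E₂_equation_iff {K : Type} [Field K] [Algebra ℚ K] (x y : K) :
    (Thorne2019.E₂.baseChange K).toAffine.Equation x y ↔ y ^ 2 + x * y + y = x ^ 3 + x ^ 2 - 5 * x + 2 := by
  rw [WeierstrassCurve.Affine.equation_iff]
  simp only [WeierstrassCurve.baseChange, WeierstrassCurve.map_a₁, WeierstrassCurve.map_a₂,
    WeierstrassCurve.map_a₃, WeierstrassCurve.map_a₄, WeierstrassCurve.map_a₆, Thorne2019.E₂, map_one, map_neg,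
    map_ofNat, one_mul]
  constructor <;> intro h <;> linear_combination h

/-- THE `2`-ISOGENY `φ : E₂ → E₁` WITH KERNEL `⟨(1,−1)⟩` (Vélu): `φ(x,y) = (x + 1/(x−1), y − (x+y)/(x−1)²)` carries the
affine points of `E₂` off the kernel to affine points of `E₁` — a kernel-checked identity
`(x−1)⁶ · (E₁-equation at φ(x,y)) = x²(x−1)²(x−2)² · (E₂-equation at (x,y))`. [cite: Thorne2019, Prop. 4 («related by
an isogeny of degree 2»)] -/
theorem isogeny_equation {K : Type} [Field K] {x y : K} (hx : x - 1 ≠ 0)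
    (h : y ^ 2 + x * y + y = x ^ 3 + x ^ 2 - 5 * x + 2) :
    (y - (x + y) / (x - 1) ^ 2) ^ 2 + (x + 1 / (x - 1)) * (y - (x + y) / (x - 1) ^ 2)
        + (y - (x + y) / (x - 1) ^ 2)
      = (x + 1 / (x - 1)) ^ 3 + (x + 1 / (x - 1)) ^ 2 - 10 * (x + 1 / (x - 1)) - 10 := by
  have key : ((y - (x + y) / (x - 1) ^ 2) ^ 2 + (x + 1 / (x - 1)) * (y - (x + y) / (x - 1) ^ 2)
        + (y - (x + y) / (x - 1) ^ 2)
        - ((x + 1 / (x - 1)) ^ 3 + (x + 1 / (x - 1)) ^ 2 - 10 * (x + 1 / (x - 1)) - 10)) * (x - 1) ^ 6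
      = x ^ 2 * (x - 1) ^ 2 * (x - 2) ^ 2 * (y ^ 2 + x * y + y - (x ^ 3 + x ^ 2 - 5 * x + 2)) := by
    field_simp
    ring
  have h0 : y ^ 2 + x * y + y - (x ^ 3 + x ^ 2 - 5 * x + 2) = 0 := sub_eq_zero.mpr h
  rw [h0, mul_zero] at key
  exact sub_eq_zero.mp ((mul_eq_zero.mp key).resolve_right (pow_ne_zero 6 hx))

/-- A field with no quadratic subfield contains no irrational root of a rational quadratic. -/
theorem mem_range_of_quadratic {K : Type} [Field K] [NumberField K] (hK : NoQuadraticSubfield K) (z : K) (b c : ℚ)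
    (hz : z ^ 2 + algebraMap ℚ K b * z + algebraMap ℚ K c = 0) : z ∈ Set.range (algebraMap ℚ K) := by
  classical
  let p : ℚ[X] := Polynomial.X ^ 2 + Polynomial.C b * Polynomial.X + Polynomial.C c
  have hmonic : p.Monic := by
    show (Polynomial.X ^ 2 + Polynomial.C b * Polynomial.X + Polynomial.C c : ℚ[X]).Monic
    monicity!
  have hdeg : p.natDegree = 2 := by
    show (Polynomial.X ^ 2 + Polynomial.C b * Polynomial.X + Polynomial.C c : ℚ[X]).natDegree = 2
    compute_degree!
  have heval : Polynomial.aeval z p = 0 := by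
    simp only [p, map_add, map_mul, map_pow, Polynomial.aeval_X, Polynomial.aeval_C]
    exact hz
  have hint : IsIntegral ℚ z := ⟨p, hmonic, by simpa [Polynomial.aeval_def] using heval⟩
  have hfin : Module.finrank ℚ ℚ⟮z⟯ = (minpoly ℚ z).natDegree := IntermediateField.adjoin.finrank hint
  have hle : (minpoly ℚ z).natDegree ≤ 2 := by
    rw [← hdeg]
    exact Polynomial.natDegree_le_natDegree (minpoly.min ℚ z hmonic heval)
  have hpos : 0 < Module.finrank ℚ ℚ⟮z⟯ := Module.finrank_pos
  have h2 : Module.finrank ℚ ℚ⟮z⟯ ≠ 2 := hK ℚ⟮z⟯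
  have h1 : Module.finrank ℚ ℚ⟮z⟯ = 1 := by omega
  have hbot : ℚ⟮z⟯ = ⊥ := IntermediateField.finrank_eq_one_iff.mp h1
  have hmem : z ∈ (⊥ : IntermediateField ℚ K) := by
    rw [← hbot]; exact IntermediateField.mem_adjoin_simple_self ℚ z
  exact IntermediateField.mem_bot.mp hmem

/-- Odd degree (more generally `2 ∤ [K:ℚ]`) ⇒ no quadratic subfield (tower law). -/
theorem noQuadraticSubfield_of_not_two_dvd {K : Type} [Field K] [NumberField K] (h2 : ¬ 2 ∣ Module.finrank ℚ K) :
    NoQuadraticSubfield K := by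
  intro F hF
  apply h2
  refine ⟨Module.finrank F K, ?_⟩
  rw [← hF, Module.finrank_mul_finrank ℚ F K]

/-- DESCENT OF STABILITY through the `2`-isogeny (Yoshikawa's Cor. 3.3 generalised from «odd degree» to «no quadratic
subfield»): if `E₁(K) = E₁(ℚ)` and `K` has no quadratic subfield then `E₂(K) = E₂(ℚ)`.  Proof: for `(x,y) ∈ E₂(K)` off
the kernel, `φ(x,y) ∈ E₁(K) = E₁(ℚ)`, so `x` is a root of the RATIONAL quadratic `X² − (1+q)X + (1+q)` (`q = x(φ(x,y))`),
hence rational; then `y` is a root of a rational quadratic, hence rational. [cite: Yoshikawa2022, Cor. 3.3 (odd degree)] -/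
theorem pointsRational_E₂_of_E₁ {K : Type} [Field K] [NumberField K] (hK : NoQuadraticSubfield K)
    (h₁ : Thorne2019.PointsRational Thorne2019.E₁ K) : Thorne2019.PointsRational Thorne2019.E₂ K := by
  intro x y hxy
  rw [E₂_equation_iff] at hxy
  have hx : x ∈ Set.range (algebraMap ℚ K) := by
    by_cases h1 : x = 1
    · exact ⟨1, by rw [h1, map_one]⟩
    · have hx1 : x - 1 ≠ 0 := sub_ne_zero.mpr h1
      obtain ⟨⟨q, hq⟩, -⟩ := h₁ _ _ ((E₁_equation_iff _ _).mpr (isogeny_equation hx1 hxy))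
      apply mem_range_of_quadratic hK x (-(1 + q)) (1 + q)
      have hq' : algebraMap ℚ K q * (x - 1) = x * (x - 1) + 1 := by
        rw [hq]; field_simp
      simp only [map_neg, map_add, map_one]
      linear_combination -hq'
  obtain ⟨q, rfl⟩ := hx
  refine ⟨⟨q, rfl⟩, ?_⟩
  apply mem_range_of_quadratic hK y (q + 1) (-(q ^ 3 + q ^ 2 - 5 * q + 2))
  simp only [map_add, map_neg, map_sub, map_mul, map_pow, map_one, map_ofNat]
  linear_combination hxy

/-- Hence on fields WITHOUT QUADRATIC SUBFIELD the dial reads one curve only: `E₁(K) = E₁(ℚ) ⇒ FifteenStable K`. -/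
theorem fifteenStable_of_E₁ {K : Type} [Field K] [NumberField K] (hK : NoQuadraticSubfield K)
    (h₁ : Thorne2019.PointsRational Thorne2019.E₁ K) : FifteenStable K :=
  ⟨h₁, pointsRational_E₂_of_E₁ hK h₁⟩

/-- The odd-degree case VERBATIM as in [Yoshikawa2022, Cor. 3.3] / the B5 guard of `TowerDoorSplit` (`X₀(15)` alone). -/
theorem fifteenStable_of_E₁_of_odd {K : Type} [Field K] [NumberField K] (hodd : Odd (Module.finrank ℚ K))
    (h₁ : Thorne2019.PointsRational Thorne2019.E₁ K) : FifteenStable K :=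
  fifteenStable_of_E₁ (noQuadraticSubfield_of_not_two_dvd (by obtain ⟨k, hk⟩ := hodd; omega)) h₁

/-- THE STABLE CELL ON PRIMITIVE FIELDS (pointwise corollary, CLOSED): over an unanchored totally real `K₀` with no
quadratic subfield, `√5 ∉ K₀` and `E₁(K₀) = E₁(ℚ)` — one descent computation on 15A1 — EVERY integral `E` is modular,
given BOX13, FMD, DBC. -/
theorem modular_of_E₁Stable (hB : Box2022_theorem1_3) (hF : FifteenModuliDoor) (hDBC : RatBaseChangeModularity)
    (K₀ : Type) [Field K₀] [NumberField K₀] (hb : UnanchoredBox K₀) (hK : NoQuadraticSubfield K₀)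
    (h5 : ¬ IsSquare (5 : K₀)) (h₁ : Thorne2019.PointsRational Thorne2019.E₁ K₀)
    (E : WeierstrassCurve (𝓞 K₀)) (hΔ : E.Δ ≠ 0) : IsModularEllipticCurve K₀ E :=
  stableCell_closed hB hF hDBC K₀ hb h5 (fifteenStable_of_E₁ hK h₁) E hΔ

/-! ## §8 Sanity: the kernel point and the images of the listed points (the isogeny is the right one) -/

/-- `(1, −1)` is the kernel point of `φ` on `E₂` and `φ` maps `E₂(ℚ) ∖ {O, (1,−1)}` into the LISTED points of `E₁`:
`φ(0,−2) = (−1,0)`, `φ(2,1) = (3,−2)`, `φ(−3,1) = (−13/4, 9/8)` (kernel-checked arithmetic). -/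
theorem isogeny_on_listed_points :
    ((0 : ℚ) + 1 / (0 - 1), (-2 : ℚ) - (0 + (-2)) / (0 - 1) ^ 2) ∈ Thorne2019.E₁Points ∧
    ((2 : ℚ) + 1 / (2 - 1), (1 : ℚ) - (2 + 1) / (2 - 1) ^ 2) ∈ Thorne2019.E₁Points ∧
    ((-3 : ℚ) + 1 / (-3 - 1), (1 : ℚ) - (-3 + 1) / (-3 - 1) ^ 2) ∈ Thorne2019.E₁Points := by
  refine ⟨?_, ?_, ?_⟩ <;> norm_num [Thorne2019.E₁Points]


end Summit.Langlands.Langlands.Theorems.MordellWeilFifteenSplit
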